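import Summits.CriticalPhenomena.PercolationContinuityZ3.Theorems.PercNearOneGluingNoHeavyLowerTailMixCSHRminus
import Summits.CriticalPhenomena.PercolationContinuityZ3.Theorems.PercNearOneGluingNoHeavyLowerTailMixCSHUnfoldTools
import HarnessLib

/-!
# Mixed conditioned slack hierarchy — the hub-row remainder `hubRem ≤ 0` (the hypothesis `hR` of the mixed Lemma U)

Support file (`--supports stmt-CriticalPhenomena-4575`), prover `prim-ineq-gen-7` (gen 9).  No definitions, no named facts, no sorries.
Memo `prim-ineq-gen-7/PROOF-Q9-MIXED-CSH.md` §3.2–3.3; interface memo `prim-hp-7/FROM-prim-hp-7-g33-MIXUNFOLD.md` (brick B2, prim-hp-7 gen 33).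

prim-hp-7's mixed Lemma U (`MixCSH.mix_within_nonneg`, brick B2) isolates, for every decoy `d` with earlier sources `S ∋ x`, the hub-row remainder
`MixCSH.hubRem ŵ x Y g Σ d (S ∪ Y) = Σ_ζ w(ζ)·1{d ↮ S∪Y}·1{Σ ↔ d}·Cov_{world ζ∖cut_d}(Θ, 1{Σ ↮ S∪Y})` (= `μ(E_j)·R_j` of the memo) and asks for
`hubRem ≤ 0` (its hypothesis `hR`).  THIS FILE supplies it from LEMMA R⁻ (`MixCSH.rminus_cut`, brick B3): world by world the covariance is `≤ 0`.
* `MixCSH.hubAvoidInd_eq_ind` — prim-hp-7's frozen factor `hubAvoidInd Σ A` is the indicator used in `rminus_cut` (orientation of `↮` swapped);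
* `MixCSH.wcovOff_resid_hubAvoidInd_nonpos` — `Cov_{world ζ∖cut_d}(Θ, 1{Σ ↮ A}) ≤ 0` for `ζ ∈ {d ↮ A}`, `Y ⊆ A`, `g` monotone;
* `MixCSH.hubRem_nonpos` — `hubRem ŵ x Y g Σ d (S ∪ Y) ≤ 0` for every `S`, every monotone `g` (weights in `[0,1]`).
[cite: VandenbergHaggstromKahn2005, Thm. 1.1 (pp. 3–5), §2.1 Lemma 2.4 (p. 10)] [cite: KozmaNitzan2024, Question 9 (§5.5 p. 36)]
-/

noncomputable section

namespace Summit.CriticalPhenomena.PercolationContinuityZ3.Theorems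

open MeasureTheory Set Literature.Probability.LatticeModels Literature.Probability.Percolation
open scoped Classical
open BHK2006 DecisionTree HullPort CSH

namespace MixCSH

variable {V : Type*}

/-- prim-hp-7's frozen avoidance factor is the indicator of `{Σ ↮ A}` used by Lemma R⁻ (the orientation of `↮` is immaterial). [folklore] -/
theorem hubAvoidInd_eq_ind (Sig A : Set V) (β : Set (Sym2 V)) :
    hubAvoidInd Sig A β = ind {β : Set (Sym2 V) | ∀ σ ∈ Sig, ∀ a ∈ A, ¬ (openGraph β).Reachable σ a} β := by
  have hiff : (∀ z ∈ Sig, ∀ a ∈ A, ¬ (openGraph β).Reachable a z) ↔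
      β ∈ {β : Set (Sym2 V) | ∀ σ ∈ Sig, ∀ a ∈ A, ¬ (openGraph β).Reachable σ a} := by
    simp only [mem_setOf_eq]
    exact forall₂_congr fun z _ => forall₂_congr fun a _ =>
      not_congr ⟨fun h => h.symm, fun h => h.symm⟩
  unfold hubAvoidInd
  by_cases h : β ∈ {β : Set (Sym2 V) | ∀ σ ∈ Sig, ∀ a ∈ A, ¬ (openGraph β).Reachable σ a}
  · rw [if_pos (hiff.2 h), ind_of_mem h]
  · rw [if_neg (fun h' => h (hiff.1 h')), ind_of_not_mem h]

variable [Fintype V]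

/-- **The world covariance of the residual with the frozen hub factor is nonpositive** (Lemma R⁻ world by world): for `ζ ∈ {d ↮ A}`, `Y ⊆ A`,
`g` monotone and weights in `[0,1]`, `Cov_{world ζ∖cut_d}(Θ, 1{Σ ↮ A}) ≤ 0`. [cite: VandenbergHaggstromKahn2005, Thm. 1.1 (pp. 3–5), §2.1 Lemma 2.4 (p. 10)] -/
theorem wcovOff_resid_hubAvoidInd_nonpos (w : Sym2 V → ℝ) (hw0 : ∀ e, 0 ≤ w e) (hw1 : ∀ e, w e ≤ 1) (hm : ∑ ω, weight w ω = 1)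
    (x d : V) {Y A : Set V} (hYA : Y ⊆ A) (Sig : Set V) {g : Set (Sym2 V) → ℝ} (hg : Monotone g)
    {ζ : Set (Sym2 V)} (hζ : ζ ∈ avoidEv d A) :
    wcovOff w {d} (resid w x Y g) (hubAvoidInd Sig A) ζ ≤ 0 := by
  have h := rminus_cut w hw0 hw1 hm x d hYA Sig hg hζ
  unfold wcovOff wmeanOff
  simp only [hubAvoidInd_eq_ind]
  linarith

/-- **`hubRem ≤ 0`** — the hypothesis `hR` of prim-hp-7's mixed Lemma U `MixCSH.mix_within_nonneg`: for every source set `S`, decoy `d`, hub set `Σ`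
and monotone `g`, `hubRem ŵ x Y g Σ d (S ∪ Y) ≤ 0` (weights `ŵ = ↑w ∈ [0,1]`). [cite: VandenbergHaggstromKahn2005, Thm. 1.1 (pp. 3–5)]
[cite: KozmaNitzan2024, Question 9 (§5.5 p. 36)] -/
theorem hubRem_nonpos (w : Sym2 V → unitInterval) (x : V) (Y : Set V) {g : Set (Sym2 V) → ℝ} (hg : Monotone g) (Sig : Set V)
    (d : V) (S : Set V) :
    hubRem (fun e => (w e : ℝ)) x Y g Sig d (S ∪ Y) ≤ 0 := by
  have hw0 : ∀ e, 0 ≤ (w e : ℝ) := fun e => (w e).2.1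
  have hw1 : ∀ e, (w e : ℝ) ≤ 1 := fun e => (w e).2.2
  have hm : ∑ ω, weight (fun e => (w e : ℝ)) ω = 1 := by
    have h1 := integral_prodBernoulli_eq_sum w fun _ => (1 : ℝ)
    simp only [integral_const, probReal_univ, smul_eq_mul, mul_one] at h1
    exact h1.symm
  unfold hubRem
  refine Finset.sum_nonpos fun ζ _ => mul_nonpos_iff.2 (Or.inl ⟨weight_nonneg hw0 hw1 ζ, ?_⟩)
  by_cases hζ : ζ ∈ avoidEv d (S ∪ Y)
  · exact mul_nonpos_iff.2 (Or.inl ⟨mul_nonneg (ind_nonneg _ _) (ind_nonneg _ _),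
      wcovOff_resid_hubAvoidInd_nonpos _ hw0 hw1 hm x d subset_union_right Sig hg hζ⟩)
  · rw [ind_of_not_mem hζ, zero_mul, zero_mul]

end MixCSH

end Summit.CriticalPhenomena.PercolationContinuityZ3.Theorems
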